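import Literature.Geometry.Kaehler.HolomorphicLineBundleCech
import HarnessLib

/-!
# The Čech complex of a framed cover with coefficients in a skyscraper: restriction to a subset `Z`

Layer `Literature/Geometry/Kaehler`, companion of `HolomorphicLineBundleCech` (the Čech complex
`C^•(𝔙, 𝒪(L))` of the sheaf of sections of a cocycle line bundle `L` on a framed cover
`𝔙 = (V_k, frame k)`, a section over `V_J` being a holomorphic function in the frame of the first
index `J 0`, restriction maps `face` = change of frame `trans` and restriction, differential `delta`).
For a subset `Z ⊆ M` (in the application the finite set of common zeros of the local equations
`t, t'` of two transversal hyperplane sections of a projective surface) we form the same complex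
with coefficients in ALL functions supported in `Z ∩ V_J` — the Čech complex `C^•(𝔙, L|_Z)` of the
"skyscraper" `L|_Z = 𝒪(L) ⊗ 𝒪_M/𝓘_Z` read on the nerve (J.-P. Serre, *Faisceaux algébriques
cohérents* (1955), n° 18, n° 20–21; R. Godement, *Topologie algébrique et théorie des faisceaux*
(1958), II.5.2) — and prove the two facts used by the dimension count of Serre's théorème A for line
bundles (*FAC* n° 81; *GAGA* (1956) n° 16 Lemme 8) at the bottom, skyscraper, level:

* `suppFunOn W` — functions `M → ℂ` vanishing off `W`; `FramedCover.ZCochain C Z a`,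
  `zface`, `zdelta`, `zdelta_zdelta`, `zcohomology` — the complex `C^•(𝔙, L|_Z)` (same formulas as
  `Cochain`, `face`, `delta`, `cohomology`);
* `FramedCover.toZ` — **restriction to `Z`**, the cochain map `C^•(𝔙, 𝒪(L)) → C^•(𝔙, L|_Z)`
  (`toZ_delta`);
* `FramedCover.coneFun`/`cone`, `zdelta_cone_add_cone_zdelta` — **the cone contraction**
  `(h c)_J(x) = g_{frame k(x), frame J₀}(x) · c_{(k(x), J)}(x)` for a choice `x ∈ V_{k(x)}`
  (Bott–Tu (1982), Prop. 8.5, with the change of frame; `CechTuple.cons_comp_succAbove_zero/succ`),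
  whence **`Ȟ^q(𝔙, L|_Z) = 0` for `q ≥ 1`** (`subsingleton_zcohomology_succ`): a skyscraper is
  flasque, Godement II.3.1 / II.5.2.3;
* `FramedCover.pointCocycle`, `nontrivial_zcohomology_zero` — for `z₀ ∈ Z ∩ V_{k₀}` the `0`-cocycle
  `J ↦ g_{frame k₀, frame J₀}(z₀) · 𝟙_{z₀}` is non-zero, so **`Ȟ⁰(𝔙, L|_Z) ≠ 0`** as soon as `Z`
  meets the cover;
* `finiteDimensional_zCochain`, `finiteDimensional_zcohomology` — for `Z` finite and finitely many
  members, the cochains and the cohomology are finite-dimensional.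

Everything is proved; the definitions are the carriers and maps listed.

## References

* J.-P. Serre, *Faisceaux algébriques cohérents*, Ann. of Math. 61 (1955), n° 18, 20, 21, 81.
  [SerreFAC1955]
* R. Bott, L. W. Tu, *Differential Forms in Algebraic Topology* (1982), Prop. 8.5. [BottTu1982Forms]
* R. Godement, *Topologie algébrique et théorie des faisceaux* (1958), II.3.1, II.5.2.
  [Godement1958]
-/

noncomputable section

open scoped Manifold ContDiff Topology
open Set Filter Function Literature.Algebra.Homology

namespace Literature.Geometry.Kaehler

variable {ι κ : Type*} {E : Type*} [NormedAddCommGroup E] [NormedSpace ℂ E]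
  {M : Type*} [TopologicalSpace M] [ChartedSpace E M]

/-! ### Functions supported in a subset -/

omit [ChartedSpace E M] in
/-- **Functions `M → ℂ` supported in `W`** (vanishing off `W`), a `ℂ`-submodule of `M → ℂ`: the
sections over `W` of the sheaf of ALL (discontinuous) functions, normalised by zero as `holFunOn`.
[cite: Godement1958, II.3.1] -/
def suppFunOn (M : Type*) (W : Set M) : Submodule ℂ (M → ℂ) where
  carrier := {f | ∀ x ∉ W, f x = 0}
  add_mem' hf hg := fun x hx ↦ by rw [Pi.add_apply, hf x hx, hg x hx, add_zero]
  zero_mem' := fun _ _ ↦ rfl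
  smul_mem' c _ hf := fun x hx ↦ by rw [Pi.smul_apply, hf x hx, smul_zero]

namespace suppFunOn

variable {W W' : Set M}

omit [TopologicalSpace M] [ChartedSpace E M] in
/-- Membership in `suppFunOn`. [folklore] -/
theorem mem_iff {f : M → ℂ} : f ∈ suppFunOn M W ↔ ∀ x ∉ W, f x = 0 :=
  Iff.rfl

omit [TopologicalSpace M] [ChartedSpace E M] in
/-- An element of `suppFunOn M W` vanishes off `W`. [folklore] -/
theorem apply_of_notMem (f : suppFunOn M W) {x : M} (hx : x ∉ W) : (f : M → ℂ) x = 0 :=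
  f.2 x hx

omit [TopologicalSpace M] [ChartedSpace E M] in
/-- **Multiply by a function and restrict to `W' ⊆ W`**: `f ↦ (g f)|_{W'}` extended by zero (the
shape of the restriction maps of a twisted sheaf). [folklore] -/
def mulRestrict (W' : Set M) (g : M → ℂ) : suppFunOn M W →ₗ[ℂ] suppFunOn M W' where
  toFun f := ⟨W'.indicator fun x ↦ g x * (f : M → ℂ) x, fun x hx ↦ indicator_of_notMem hx _⟩
  map_add' f f' := by
    refine Subtype.ext (funext fun x ↦ ?_)
    by_cases hx : x ∈ W'
    · simp only [Submodule.coe_add, Pi.add_apply, indicator_of_mem hx, mul_add]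
    · simp only [Submodule.coe_add, Pi.add_apply, indicator_of_notMem hx, add_zero]
  map_smul' c f := by
    refine Subtype.ext (funext fun x ↦ ?_)
    by_cases hx : x ∈ W'
    · simp only [Submodule.coe_smul, Pi.smul_apply, smul_eq_mul, indicator_of_mem hx,
        RingHom.id_apply]
      ring
    · simp only [Submodule.coe_smul, Pi.smul_apply, smul_eq_mul, indicator_of_notMem hx,
        RingHom.id_apply, mul_zero]

omit [TopologicalSpace M] [ChartedSpace E M] in
/-- `mulRestrict` at a point of `W'`. [folklore] -/
theorem mulRestrict_apply_of_mem (W' : Set M) (g : M → ℂ) (f : suppFunOn M W) {x : M} (hx : x ∈ W') :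
    (mulRestrict W' g f : M → ℂ) x = g x * (f : M → ℂ) x := by
  change W'.indicator (fun x ↦ g x * (f : M → ℂ) x) x = _
  exact indicator_of_mem hx _

omit [TopologicalSpace M] [ChartedSpace E M] in
/-- `mulRestrict` off `W'`. [folklore] -/
theorem mulRestrict_apply_of_notMem (W' : Set M) (g : M → ℂ) (f : suppFunOn M W) {x : M}
    (hx : x ∉ W') : (mulRestrict W' g f : M → ℂ) x = 0 := by
  change W'.indicator (fun x ↦ g x * (f : M → ℂ) x) x = _
  exact indicator_of_notMem hx _

omit [TopologicalSpace M] [ChartedSpace E M] in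
/-- **Functions supported in a finite set form a finite-dimensional space** (they embed in
`W → ℂ`). [folklore] -/
theorem finiteDimensional (hW : W.Finite) : FiniteDimensional ℂ (suppFunOn M W) := by
  haveI : Finite W := hW.to_subtype
  let r : suppFunOn M W →ₗ[ℂ] (W → ℂ) :=
    { toFun := fun f x ↦ (f : M → ℂ) x
      map_add' := fun _ _ ↦ rfl
      map_smul' := fun _ _ ↦ rfl }
  refine FiniteDimensional.of_injective r fun f f' h ↦ ?_
  refine Subtype.ext (funext fun x ↦ ?_)
  by_cases hx : x ∈ W
  · exact congr_fun h ⟨x, hx⟩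
  · rw [apply_of_notMem f hx, apply_of_notMem f' hx]

end suppFunOn

namespace holFunOn

variable {W : Set M}

/-- **Restriction of a holomorphic function on `W` to `Z ∩ W`** as a function supported there
(evaluation of sections of `𝒪(L)` on the skyscraper). [cite: SerreFAC1955, n° 81] -/
def restrictSupp (Z : Set M) : holFunOn E W →ₗ[ℂ] suppFunOn M (Z ∩ W) where
  toFun f := ⟨(Z ∩ W).indicator (f : M → ℂ), fun x hx ↦ indicator_of_notMem hx _⟩
  map_add' f f' := Subtype.ext (indicator_add _ _ _)
  map_smul' c f := Subtype.ext (by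
    change (Z ∩ W).indicator (c • (f : M → ℂ)) = c • (Z ∩ W).indicator (f : M → ℂ)
    exact indicator_const_smul _ c _)

/-- `restrictSupp` at a point of `Z ∩ W`. [folklore] -/
theorem restrictSupp_apply_of_mem (Z : Set M) (f : holFunOn E W) {x : M} (hx : x ∈ Z ∩ W) :
    (restrictSupp Z f : M → ℂ) x = (f : M → ℂ) x :=
  indicator_of_mem hx _

/-- `restrictSupp` off `Z ∩ W`. [folklore] -/
theorem restrictSupp_apply_of_notMem (Z : Set M) (f : holFunOn E W) {x : M} (hx : x ∉ Z ∩ W) :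
    (restrictSupp Z f : M → ℂ) x = 0 :=
  indicator_of_notMem hx _

end holFunOn

namespace HolomorphicLineBundle

namespace FramedCover

variable {L : HolomorphicLineBundle ι E M} (C : L.FramedCover κ) (Z : Set M)

/-! ### The skyscraper Čech complex `C^•(𝔙, L|_Z)` -/

/-- **The cochains `C^a(𝔙, L|_Z) = Π_J {functions supported in Z ∩ V_J}`**, the component over
`V_J` read in the frame of the first index `J 0`. [cite: SerreFAC1955, n° 18] -/
abbrev ZCochain (a : ℕ) : Type _ :=
  ∀ J : Fin (a + 1) → κ, ↥(suppFunOn M (Z ∩ cechSet C.U J))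

/-- The restriction map of the skyscraper along a map of tuples: restrict to `Z ∩ V_J` and convert
to the frame of `J 0` (same change of frame `trans` as for `𝒪(L)`). [cite: SerreFAC1955, n° 18] -/
def zface {m n : ℕ} (J : Fin (n + 1) → κ) (τ : Fin (m + 1) → Fin (n + 1)) :
    ↥(suppFunOn M (Z ∩ cechSet C.U (J ∘ τ))) →ₗ[ℂ] ↥(suppFunOn M (Z ∩ cechSet C.U J)) :=
  suppFunOn.mulRestrict (Z ∩ cechSet C.U J) (C.trans J τ)

/-- The restriction map at a point of `Z ∩ V_J`. [folklore] -/
theorem zface_apply_of_mem {m n : ℕ} (J : Fin (n + 1) → κ) (τ : Fin (m + 1) → Fin (n + 1))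
    (f : suppFunOn M (Z ∩ cechSet C.U (J ∘ τ))) {x : M} (hx : x ∈ Z ∩ cechSet C.U J) :
    (C.zface Z J τ f : M → ℂ) x = C.trans J τ x * (f : M → ℂ) x :=
  suppFunOn.mulRestrict_apply_of_mem _ _ f hx

/-- The restriction map off `Z ∩ V_J`. [folklore] -/
theorem zface_apply_of_notMem {m n : ℕ} (J : Fin (n + 1) → κ) (τ : Fin (m + 1) → Fin (n + 1))
    (f : suppFunOn M (Z ∩ cechSet C.U (J ∘ τ))) {x : M} (hx : x ∉ Z ∩ cechSet C.U J) :
    (C.zface Z J τ f : M → ℂ) x = 0 :=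
  suppFunOn.mulRestrict_apply_of_notMem _ _ f hx

/-- **Functoriality of the restriction maps** of the skyscraper (presheaf on the nerve).
[cite: SerreFAC1955, n° 18] -/
theorem zface_zface {l m n : ℕ} (J : Fin (n + 1) → κ) (τ : Fin (m + 1) → Fin (n + 1))
    (τ' : Fin (l + 1) → Fin (m + 1)) (f : suppFunOn M (Z ∩ cechSet C.U (J ∘ τ ∘ τ'))) :
    C.zface Z J τ (C.zface Z (J ∘ τ) τ' f) = C.zface Z J (τ ∘ τ') f := by
  refine Subtype.ext (funext fun x ↦ ?_)
  by_cases hx : x ∈ Z ∩ cechSet C.U J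
  · rw [C.zface_apply_of_mem Z J τ _ hx, C.zface_apply_of_mem Z J (τ ∘ τ') _ hx,
      C.zface_apply_of_mem Z (J ∘ τ) τ' _ ⟨hx.1, cechSet_subset_comp C.U J τ hx.2⟩, ← mul_assoc,
      C.trans_mul_trans J τ τ' hx.2]
  · rw [C.zface_apply_of_notMem Z J τ _ hx, C.zface_apply_of_notMem Z J (τ ∘ τ') _ hx]

/-- **The Čech differential of `C^•(𝔙, L|_Z)`**, `(δ c)_J = Σ_j (-1)^j c_{J ∘ σ_j}|_{Z ∩ V_J}` (the
`0`-th face carrying the change of frame). [cite: SerreFAC1955, n° 18] -/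
def zdelta (a : ℕ) : C.ZCochain Z a →ₗ[ℂ] C.ZCochain Z (a + 1) where
  toFun c J := ∑ j : Fin (a + 2), (-1 : ℂ) ^ (j : ℕ) • C.zface Z J (Fin.succAbove j) (c (J ∘ Fin.succAbove j))
  map_add' c c' := by
    funext J
    simp only [Pi.add_apply, map_add, smul_add, Finset.sum_add_distrib]
  map_smul' r c := by
    funext J
    simp only [Pi.smul_apply, map_smul, RingHom.id_apply, Finset.smul_sum, smul_smul, mul_comm r]

/-- The Čech differential of the skyscraper, componentwise. [cite: SerreFAC1955, n° 18] -/
theorem zdelta_apply {a : ℕ} (c : C.ZCochain Z a) (J : Fin (a + 2) → κ) :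
    C.zdelta Z a c J = ∑ j : Fin (a + 2), (-1 : ℂ) ^ (j : ℕ) •
      C.zface Z J (Fin.succAbove j) (c (J ∘ Fin.succAbove j)) :=
  rfl

/-- The Čech differential of the skyscraper at a point of `Z ∩ V_J`. [folklore] -/
theorem zdelta_apply_apply_of_mem {a : ℕ} (c : C.ZCochain Z a) {J : Fin (a + 2) → κ} {x : M}
    (hx : x ∈ Z ∩ cechSet C.U J) :
    (C.zdelta Z a c J : M → ℂ) x = ∑ j : Fin (a + 2), (-1 : ℂ) ^ (j : ℕ) *
      (C.trans J (Fin.succAbove j) x * (c (J ∘ Fin.succAbove j) : M → ℂ) x) := by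
  rw [zdelta_apply, Submodule.coe_sum, Finset.sum_apply]
  refine Finset.sum_congr rfl fun j _ ↦ ?_
  rw [Submodule.coe_smul, Pi.smul_apply, smul_eq_mul, C.zface_apply_of_mem Z J _ _ hx]

/-- The Čech differential of the skyscraper vanishes off `Z ∩ V_J` (support). [folklore] -/
theorem zdelta_apply_apply_of_notMem {a : ℕ} (c : C.ZCochain Z a) {J : Fin (a + 2) → κ} {x : M}
    (hx : x ∉ Z ∩ cechSet C.U J) : (C.zdelta Z a c J : M → ℂ) x = 0 :=
  suppFunOn.apply_of_notMem _ hx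

/-- **`δ ∘ δ = 0`** on `C^•(𝔙, L|_Z)`. [cite: SerreFAC1955, n° 18] -/
theorem zdelta_zdelta (a : ℕ) (c : C.ZCochain Z a) : C.zdelta Z (a + 1) (C.zdelta Z a c) = 0 := by
  funext J
  rw [zdelta_apply, Pi.zero_apply]
  simp only [zdelta_apply, map_sum, map_smul, zface_zface, Finset.smul_sum]
  exact CechTuple.sum_sum_neg_one_pow_smul_smul_faces_eq_zero (R := ℂ)
    (fun θ ↦ C.zface Z J θ (c (J ∘ θ)))

/-- **The Čech cohomology `Ȟ^q(𝔙, L|_Z)`** of the framed cover with coefficients in the skyscraper,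
in the tree's format `NatCochain.Cohomology`. [cite: SerreFAC1955, n° 18] -/
def zcohomology (q : ℕ) : Type _ :=
  NatCochain.Cohomology (R := ℂ) (fun a ↦ C.zdelta Z a) q

/-- The additive structure of `Ȟ^q(𝔙, L|_Z)`. [folklore] -/
instance instAddCommGroupZCohomology (q : ℕ) : AddCommGroup (C.zcohomology Z q) :=
  inferInstanceAs (AddCommGroup (NatCochain.Cohomology (R := ℂ) (fun a ↦ C.zdelta Z a) q))

/-- The `ℂ`-module structure of `Ȟ^q(𝔙, L|_Z)`. [folklore] -/
instance instModuleZCohomology (q : ℕ) : Module ℂ (C.zcohomology Z q) :=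
  inferInstanceAs (Module ℂ (NatCochain.Cohomology (R := ℂ) (fun a ↦ C.zdelta Z a) q))

/-! ### Restriction to `Z`: the cochain map `C^•(𝔙, 𝒪(L)) → C^•(𝔙, L|_Z)` -/

/-- **Restriction of sections of `𝒪(L)` to the skyscraper**, componentwise `c_J ↦ c_J|_{Z ∩ V_J}`.
[cite: SerreFAC1955, n° 81] -/
def toZ (a : ℕ) : C.Cochain a →ₗ[ℂ] C.ZCochain Z a where
  toFun c J := holFunOn.restrictSupp Z (c J)
  map_add' c c' := by
    funext J
    simp only [Pi.add_apply, map_add]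
  map_smul' r c := by
    funext J
    simp only [Pi.smul_apply, map_smul, RingHom.id_apply]

/-- `toZ` at a point of `Z ∩ V_J`. [folklore] -/
theorem toZ_apply_apply_of_mem {a : ℕ} (c : C.Cochain a) {J : Fin (a + 1) → κ} {x : M}
    (hx : x ∈ Z ∩ cechSet C.U J) : (C.toZ Z a c J : M → ℂ) x = (c J : M → ℂ) x :=
  holFunOn.restrictSupp_apply_of_mem Z (c J) hx

/-- `toZ` off `Z ∩ V_J`. [folklore] -/
theorem toZ_apply_apply_of_notMem {a : ℕ} (c : C.Cochain a) {J : Fin (a + 1) → κ} {x : M}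
    (hx : x ∉ Z ∩ cechSet C.U J) : (C.toZ Z a c J : M → ℂ) x = 0 :=
  holFunOn.restrictSupp_apply_of_notMem Z (c J) hx

/-- **Restriction to `Z` is a cochain map**: `(δ c)|_Z = δ (c|_Z)`. [cite: SerreFAC1955, n° 18 and n° 81] -/
theorem toZ_delta (a : ℕ) (c : C.Cochain a) :
    C.toZ Z (a + 1) (C.delta a c) = C.zdelta Z a (C.toZ Z a c) := by
  funext J
  refine Subtype.ext (funext fun x ↦ ?_)
  by_cases hx : x ∈ Z ∩ cechSet C.U J
  · rw [C.toZ_apply_apply_of_mem Z _ hx, C.delta_apply_apply_of_mem c hx.2,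
      C.zdelta_apply_apply_of_mem Z _ hx]
    refine Finset.sum_congr rfl fun j _ ↦ ?_
    rw [C.toZ_apply_apply_of_mem Z c ⟨hx.1, cechSet_subset_comp C.U J _ hx.2⟩]
  · rw [C.toZ_apply_apply_of_notMem Z _ hx, C.zdelta_apply_apply_of_notMem Z _ hx]

/-! ### The cone contraction: `Ȟ^q(𝔙, L|_Z) = 0` for `q ≥ 1` -/

section Cone

open scoped Classical in
/-- The components of the cone operator (see `cone`). [cite: BottTu1982Forms, Prop. 8.5] -/
def coneFun (k : M → κ) (a : ℕ) (c : C.ZCochain Z (a + 1)) (J : Fin (a + 1) → κ) : M → ℂ := fun x ↦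
  if x ∈ Z ∩ cechSet C.U J ∧ x ∈ C.U (k x) then
    L.coordChange (C.frame (k x)) (C.frame (J 0)) x * (c (Fin.cons (k x) J) : M → ℂ) x else 0

/-- The components of the cone operator are supported in `Z ∩ V_J`. [folklore] -/
theorem coneFun_mem (k : M → κ) (a : ℕ) (c : C.ZCochain Z (a + 1)) (J : Fin (a + 1) → κ) :
    C.coneFun Z k a c J ∈ suppFunOn M (Z ∩ cechSet C.U J) := fun x hx ↦ by
  unfold coneFun
  exact if_neg fun h ↦ hx h.1

/-- **The cone operator** `h : C^{a+1}(𝔙, L|_Z) → C^a(𝔙, L|_Z)`,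
`(h c)_J(x) = g_{frame k(x), frame J₀}(x) · c_{(k(x), J)}(x)` for `x ∈ Z ∩ V_J ∩ V_{k(x)}`
(Bott–Tu, Prop. 8.5, `(Kω)_{α₀…α_{p-1}} = Σ ρ_α ω_{α α₀ … α_{p-1}}` with the partition of unity
replaced by the choice `x ↦ k(x)` of a member through each point — possible for the sheaf of all
functions — and the component `c_{(k, J)}`, read in the frame `k`, converted to the frame `J 0`).
[cite: BottTu1982Forms, Prop. 8.5] [cite: Godement1958, II.3.1] -/
def cone (k : M → κ) (a : ℕ) : C.ZCochain Z (a + 1) →ₗ[ℂ] C.ZCochain Z a where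
  toFun c J := ⟨C.coneFun Z k a c J, C.coneFun_mem Z k a c J⟩
  map_add' c c' := by
    funext J
    refine Subtype.ext (funext fun x ↦ ?_)
    change C.coneFun Z k a (c + c') J x = C.coneFun Z k a c J x + C.coneFun Z k a c' J x
    unfold coneFun
    split_ifs
    · simp only [Pi.add_apply, Submodule.coe_add, mul_add]
    · simp
  map_smul' r c := by
    funext J
    refine Subtype.ext (funext fun x ↦ ?_)
    change C.coneFun Z k a (r • c) J x = r • C.coneFun Z k a c J x
    unfold coneFun
    split_ifs
    · simp only [Pi.smul_apply, Submodule.coe_smul, smul_eq_mul]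
      ring
    · simp

variable (k : M → κ)

open scoped Classical in
/-- The cone operator at a point of `Z ∩ V_J ∩ V_{k(x)}`. [folklore] -/
theorem cone_apply_apply_of_mem {a : ℕ} (c : C.ZCochain Z (a + 1)) {J : Fin (a + 1) → κ} {x : M}
    (hx : x ∈ Z ∩ cechSet C.U J) (hk : x ∈ C.U (k x)) :
    (C.cone Z k a c J : M → ℂ) x =
      L.coordChange (C.frame (k x)) (C.frame (J 0)) x * (c (Fin.cons (k x) J) : M → ℂ) x := by
  change C.coneFun Z k a c J x = _
  unfold coneFun
  exact if_pos ⟨hx, hk⟩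

open scoped Classical in
/-- The cone operator off `Z ∩ V_J`. [folklore] -/
theorem cone_apply_apply_of_notMem {a : ℕ} (c : C.ZCochain Z (a + 1)) {J : Fin (a + 1) → κ} {x : M}
    (hx : x ∉ Z ∩ cechSet C.U J) : (C.cone Z k a c J : M → ℂ) x = 0 :=
  suppFunOn.apply_of_notMem _ hx

/-- A point of `V_J ∩ V_{k}` lies in `V_{(k, J)}`. [folklore] -/
theorem mem_cechSet_cons {n : ℕ} {J : Fin (n + 1) → κ} {l : κ} {x : M} (hx : x ∈ cechSet C.U J)
    (hl : x ∈ C.U l) : x ∈ cechSet C.U (Fin.cons l J : Fin (n + 2) → κ) := by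
  rw [mem_cechSet_iff]
  refine Fin.cases ?_ (fun i ↦ ?_)
  · simpa using hl
  · simpa using mem_cechSet_iff.1 hx i

variable {k}

/-- **The cone identity `δ h + h δ = id` in positive degrees** (Bott–Tu, Prop. 8.5, with the change
of frame): if `k` chooses, for every point of `Z` covered by `𝔙`, a member containing it, then
`δ (h c) + h (δ c) = c` for every `c ∈ C^{a+1}(𝔙, L|_Z)`. The `0`-th face of `(k(x), J)` is `J`
(`CechTuple.cons_comp_succAbove_zero`) and contributes `c_J(x)` (the cocycle identity
`g_{k J₀} g_{J₀ k} = 1`); the `(j+1)`-st face is `(k(x), J ∘ σ_j)` (`cons_comp_succAbove_succ`) and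
cancels the `j`-th term of `δ (h c)` (for `j = 0` by `g_{J₁ J₀} g_{k J₁} = g_{k J₀}`).
[cite: BottTu1982Forms, Prop. 8.5] -/
theorem zdelta_cone_add_cone_zdelta (hk : ∀ x ∈ Z, ∀ l, x ∈ C.U l → x ∈ C.U (k x)) (a : ℕ)
    (c : C.ZCochain Z (a + 1)) :
    C.zdelta Z a (C.cone Z k a c) + C.cone Z k (a + 1) (C.zdelta Z (a + 1) c) = c := by
  funext J
  refine Subtype.ext (funext fun x ↦ ?_)
  by_cases hx : x ∈ Z ∩ cechSet C.U J
  swap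
  · rw [Pi.add_apply, Submodule.coe_add, Pi.add_apply, C.zdelta_apply_apply_of_notMem Z _ hx,
      C.cone_apply_apply_of_notMem Z k _ hx, suppFunOn.apply_of_notMem _ hx, add_zero]
  have hkx : x ∈ C.U (k x) := hk x hx.1 (J 0) (cechSet_subset_apply C.U J 0 hx.2)
  have hxK : x ∈ Z ∩ cechSet C.U (Fin.cons (k x) J : Fin (a + 3) → κ) :=
    ⟨hx.1, C.mem_cechSet_cons hx.2 hkx⟩
  -- frames and the cocycle identities at `x`
  have hb : ∀ i : Fin (a + 2), x ∈ L.baseSet (C.frame (J i)) := fun i ↦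
    C.subset _ (cechSet_subset_apply C.U J i hx.2)
  have hbk : x ∈ L.baseSet (C.frame (k x)) := C.subset _ hkx
  set gk : ℂ := L.coordChange (C.frame (k x)) (C.frame (J 0)) x with hgk
  -- `(δ (h c))_J (x)`
  have h1 : (C.zdelta Z a (C.cone Z k a c) J : M → ℂ) x =
      ∑ j : Fin (a + 2), (-1 : ℂ) ^ (j : ℕ) *
        (gk * (c (Fin.cons (k x) (J ∘ Fin.succAbove j)) : M → ℂ) x) := by
    rw [C.zdelta_apply_apply_of_mem Z _ hx]
    refine Finset.sum_congr rfl fun j _ ↦ ?_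
    have hxj : x ∈ Z ∩ cechSet C.U (J ∘ Fin.succAbove j) := ⟨hx.1, cechSet_subset_comp C.U J _ hx.2⟩
    rw [C.cone_apply_apply_of_mem Z k _ hxj hkx]
    congr 1
    rw [← mul_assoc]
    congr 1
    -- the change of frame: `trans J σ_j · g_{k, (J ∘ σ_j) 0} = g_{k, J 0}`
    by_cases hj : j = 0
    · subst hj
      change L.coordChange (C.frame (J (Fin.succAbove 0 0))) (C.frame (J 0)) x *
        L.coordChange (C.frame (k x)) (C.frame (J (Fin.succAbove 0 0))) x = gk
      rw [mul_comm]
      exact L.coordChange_comp _ _ _ x ⟨⟨hbk, hb _⟩, hb 0⟩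
    · have h0 : Fin.succAbove j 0 = 0 := Fin.succAbove_ne_zero_zero hj
      rw [C.trans_eq_one J h0 hx.2, one_mul]
      change L.coordChange (C.frame (k x)) (C.frame (J (Fin.succAbove j 0))) x = gk
      rw [h0]
  -- `(h (δ c))_J (x)`
  have h2 : (C.cone Z k (a + 1) (C.zdelta Z (a + 1) c) J : M → ℂ) x =
      (c J : M → ℂ) x + ∑ j : Fin (a + 2), (-1 : ℂ) ^ ((j : ℕ) + 1) *
        (gk * (c (Fin.cons (k x) (J ∘ Fin.succAbove j)) : M → ℂ) x) := by
    rw [C.cone_apply_apply_of_mem Z k _ hx hkx, C.zdelta_apply_apply_of_mem Z _ hxK,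
      Fin.sum_univ_succ, mul_add, Finset.mul_sum]
    congr 1
    · -- the `0`-th face of `(k, J)` is `J`, with the change of frame `g_{J 0, k}`
      have e0 : ((Fin.cons (k x) J : Fin (a + 3) → κ) ∘ Fin.succAbove 0) = J :=
        CechTuple.cons_comp_succAbove_zero (k x) J
      have ht : C.trans (Fin.cons (k x) J : Fin (a + 3) → κ) (Fin.succAbove 0) x =
          L.coordChange (C.frame (J 0)) (C.frame (k x)) x := by
        change L.coordChange (C.frame ((Fin.cons (k x) J : Fin (a + 3) → κ) (Fin.succAbove 0 0)))
          (C.frame ((Fin.cons (k x) J : Fin (a + 3) → κ) 0)) x = _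
        simp
      rw [Fin.val_zero, pow_zero, one_mul, ht, ← mul_assoc,
        L.coordChange_comp _ _ _ x ⟨⟨hbk, hb 0⟩, hbk⟩, L.coordChange_self _ hbk, one_mul]
      exact congr_fun (congr_arg (fun K ↦ ((c K : M → ℂ))) e0) x
    · refine Finset.sum_congr rfl fun j _ ↦ ?_
      have es : ((Fin.cons (k x) J : Fin (a + 3) → κ) ∘ Fin.succAbove j.succ) =
          (Fin.cons (k x) (J ∘ Fin.succAbove j) : Fin (a + 2) → κ) :=
        CechTuple.cons_comp_succAbove_succ (k x) J j
      have ht : C.trans (Fin.cons (k x) J : Fin (a + 3) → κ) (Fin.succAbove j.succ) x = 1 :=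
        C.trans_eq_one _ (Fin.succAbove_ne_zero_zero (Fin.succ_ne_zero j)) hxK.2
      rw [Fin.val_succ, ht, one_mul, es]
      ring
  rw [Pi.add_apply, Submodule.coe_add, Pi.add_apply, h1, h2, add_comm ((c J : M → ℂ) x), ← add_assoc,
    ← Finset.sum_add_distrib]
  convert zero_add ((c J : M → ℂ) x) using 2
  refine Finset.sum_eq_zero fun j _ ↦ ?_
  ring

/-- **`Ȟ^q(𝔙, L|_Z) = 0` for `q ≥ 1`**, provided every point of `Z` in a member of `𝔙` admits a
chosen member through it (always true classically when `κ` is non-empty; a skyscraper is flasque,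
Godement II.3.1, II.5.2.3): a cocycle `c` is the coboundary of `h c`.
[cite: Godement1958, II.5.2] [cite: BottTu1982Forms, Prop. 8.5] -/
theorem subsingleton_zcohomology_succ_of_choice (hk : ∀ x ∈ Z, ∀ l, x ∈ C.U l → x ∈ C.U (k x)) (q : ℕ) :
    Subsingleton (C.zcohomology Z (q + 1)) := by
  refine ⟨fun u v ↦ ?_⟩
  obtain ⟨z, rfl⟩ := NatCochain.Cohomology.mk_surjective (fun a ↦ C.zdelta Z a) (q + 1) u
  obtain ⟨z', rfl⟩ := NatCochain.Cohomology.mk_surjective (fun a ↦ C.zdelta Z a) (q + 1) v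
  have key : ∀ w : ↥(NatCochain.cocycles (R := ℂ) (fun a ↦ C.zdelta Z a) (q + 1)),
      NatCochain.Cohomology.mk (fun a ↦ C.zdelta Z a) (q + 1) w = 0 := by
    intro w
    rw [NatCochain.Cohomology.mk_eq_zero_iff, NatCochain.mem_coboundaries_succ_iff]
    refine ⟨C.cone Z k q w, ?_⟩
    have h := C.zdelta_cone_add_cone_zdelta Z hk q (w : C.ZCochain Z (q + 1))
    have hw : C.zdelta Z (q + 1) (w : C.ZCochain Z (q + 1)) = 0 :=
      (NatCochain.mem_cocycles_iff _).1 w.2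
    rwa [hw, map_zero, add_zero] at h
  change NatCochain.Cohomology.mk (fun a ↦ C.zdelta Z a) (q + 1) z =
    NatCochain.Cohomology.mk (fun a ↦ C.zdelta Z a) (q + 1) z'
  rw [key z, key z']

end Cone

/-- **`Ȟ^q(𝔙, L|_Z) = 0` for all `q ≥ 1`** (a skyscraper is flasque; Godement II.5.2.3). For
non-empty `κ` choose, for every point, a member of `𝔙` through it when there is one.
[cite: Godement1958, II.5.2] [cite: BottTu1982Forms, Prop. 8.5] -/
theorem subsingleton_zcohomology_succ [Nonempty κ] (q : ℕ) : Subsingleton (C.zcohomology Z (q + 1)) := by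
  classical
  let k : M → κ := fun x ↦ if h : ∃ l, x ∈ C.U l then h.choose else Classical.arbitrary κ
  refine C.subsingleton_zcohomology_succ_of_choice Z (k := k) (fun x _ l hl ↦ ?_) q
  have h : ∃ l, x ∈ C.U l := ⟨l, hl⟩
  change x ∈ C.U (if h : ∃ l, x ∈ C.U l then h.choose else Classical.arbitrary κ)
  rw [dif_pos h]
  exact h.choose_spec

/-! ### Degree zero: the cocycle of a point -/

/-- The skyscraper differential in degree `0` at a point of `Z ∩ V_l ∩ V_{l'}`:
`(δ c)_{(l,l')} = g_{frame l', frame l} c_{l'} - c_l`. [cite: SerreFAC1955, n° 18] -/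
theorem zdelta_zero_apply_apply (c : C.ZCochain Z 0) (l l' : κ) {x : M} (hx : x ∈ Z ∩ (C.U l ∩ C.U l')) :
    (C.zdelta Z 0 c ![l, l'] : M → ℂ) x =
      L.coordChange (C.frame l') (C.frame l) x * (c ![l'] : M → ℂ) x - (c ![l] : M → ℂ) x := by
  have hxJ : x ∈ cechSet C.U ![l, l'] := by
    rw [mem_cechSet_iff, Fin.forall_fin_two]
    exact hx.2
  have e0 : (![l, l'] : Fin 2 → κ) ∘ Fin.succAbove 0 = ![l'] := by
    funext i; fin_cases i; rfl
  have e1 : (![l, l'] : Fin 2 → κ) ∘ Fin.succAbove 1 = ![l] := by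
    funext i; fin_cases i; rfl
  have h0 : (c ((![l, l'] : Fin 2 → κ) ∘ Fin.succAbove 0) : M → ℂ) x = (c ![l'] : M → ℂ) x := by
    rw [e0]
  have h1 : (c ((![l, l'] : Fin 2 → κ) ∘ Fin.succAbove 1) : M → ℂ) x = (c ![l] : M → ℂ) x := by
    rw [e1]
  have ht0 : C.trans ![l, l'] (Fin.succAbove (0 : Fin 2)) x = L.coordChange (C.frame l') (C.frame l) x := by
    unfold trans
    simp
  have ht1 : C.trans ![l, l'] (Fin.succAbove (1 : Fin 2)) x = 1 :=
    C.trans_eq_one _ (Fin.succAbove_ne_zero_zero one_ne_zero) hxJ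
  rw [C.zdelta_apply_apply_of_mem Z c ⟨hx.1, hxJ⟩, Fin.sum_univ_two]
  simp only [Fin.val_zero, pow_zero, one_mul, Fin.val_one, pow_one, h0, h1, ht0, ht1]
  ring

section Point

variable {Z} {z₀ : M}

open scoped Classical in
/-- **The `0`-cocycle of a point `z₀ ∈ Z ∩ V_{k₀}`**: over `V_J ∋ z₀` the function `𝟙_{z₀}` times the
value `g_{frame k₀, frame J₀}(z₀)` of the frame `σ_{frame k₀}` read in the frame of `J 0` (the section
"`σ_{frame k₀}(z₀) ⊗ δ_{z₀}`" of the skyscraper). [cite: SerreFAC1955, n° 81] -/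
def pointCocycle (hz₀ : z₀ ∈ Z) (k₀ : κ) : C.ZCochain Z 0 := fun J ↦
  ⟨fun x ↦ if x = z₀ ∧ z₀ ∈ cechSet C.U J then L.coordChange (C.frame k₀) (C.frame (J 0)) z₀ else 0,
    fun x hx ↦ by
      beta_reduce
      rw [if_neg]
      rintro ⟨rfl, h2⟩
      exact hx ⟨hz₀, h2⟩⟩

variable (hz₀ : z₀ ∈ Z) {k₀ : κ}

open scoped Classical in
/-- The point cocycle at `z₀`. [folklore] -/
theorem pointCocycle_apply_self {J : Fin 1 → κ} (hJ : z₀ ∈ cechSet C.U J) :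
    (C.pointCocycle hz₀ k₀ J : M → ℂ) z₀ = L.coordChange (C.frame k₀) (C.frame (J 0)) z₀ :=
  if_pos ⟨rfl, hJ⟩

open scoped Classical in
/-- The point cocycle vanishes off `z₀`. [folklore] -/
theorem pointCocycle_apply_of_ne {J : Fin 1 → κ} {x : M} (hx : x ≠ z₀) :
    (C.pointCocycle hz₀ k₀ J : M → ℂ) x = 0 :=
  if_neg fun h ↦ hx h.1

open scoped Classical in
/-- The point cocycle vanishes on members missing `z₀`. [folklore] -/
theorem pointCocycle_apply_of_notMem {J : Fin 1 → κ} (hJ : z₀ ∉ cechSet C.U J) (x : M) :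
    (C.pointCocycle hz₀ k₀ J : M → ℂ) x = 0 :=
  if_neg fun h ↦ hJ h.2

variable (hk₀ : z₀ ∈ C.U k₀)

include hk₀ in
/-- **The point cocycle is a cocycle** (the cocycle identity `g_{l' l} g_{k₀ l'} = g_{k₀ l}` at
`z₀`). [cite: SerreFAC1955, n° 18] -/
theorem zdelta_pointCocycle : C.zdelta Z 0 (C.pointCocycle hz₀ k₀) = 0 := by
  funext J
  refine Subtype.ext (funext fun x ↦ ?_)
  have hJ : J = ![J 0, J 1] := by
    funext i; fin_cases i <;> rfl
  by_cases hx : x ∈ Z ∩ cechSet C.U J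
  swap
  · rw [C.zdelta_apply_apply_of_notMem Z _ hx]; rfl
  have hx' : x ∈ Z ∩ (C.U (J 0) ∩ C.U (J 1)) :=
    ⟨hx.1, cechSet_subset_apply C.U J 0 hx.2, cechSet_subset_apply C.U J 1 hx.2⟩
  rw [hJ, C.zdelta_zero_apply_apply Z _ (J 0) (J 1) hx']
  change _ = (0 : ℂ)
  by_cases hxz : x = z₀
  · subst hxz
    have h0 : x ∈ cechSet C.U ![J 0] := by
      rw [mem_cechSet_iff]; intro i; fin_cases i; exact hx'.2.1
    have h1 : x ∈ cechSet C.U ![J 1] := by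
      rw [mem_cechSet_iff]; intro i; fin_cases i; exact hx'.2.2
    rw [C.pointCocycle_apply_self hz₀ h1, C.pointCocycle_apply_self hz₀ h0]
    change L.coordChange (C.frame (J 1)) (C.frame (J 0)) x * L.coordChange (C.frame k₀) (C.frame (J 1)) x -
      L.coordChange (C.frame k₀) (C.frame (J 0)) x = 0
    rw [mul_comm, L.coordChange_comp _ _ _ x ⟨⟨C.subset _ hk₀, C.subset _ hx'.2.2⟩, C.subset _ hx'.2.1⟩,
      sub_self]
  · rw [C.pointCocycle_apply_of_ne hz₀ hxz, C.pointCocycle_apply_of_ne hz₀ hxz, mul_zero, sub_self]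

include hk₀ in
/-- **The point cocycle is non-zero**: its component on `V_{k₀}` takes the value `g_{k₀ k₀}(z₀) = 1`
at `z₀`. [folklore] -/
theorem pointCocycle_ne_zero : C.pointCocycle hz₀ k₀ ≠ 0 := by
  intro h
  have h1 : z₀ ∈ cechSet C.U ![k₀] := by
    rw [mem_cechSet_iff]; intro i; fin_cases i; exact hk₀
  have h2 := congr_fun (congr_arg Subtype.val (congr_fun h ![k₀])) z₀
  rw [C.pointCocycle_apply_self hz₀ h1] at h2
  change L.coordChange (C.frame k₀) (C.frame k₀) z₀ = 0 at h2
  rw [L.coordChange_self _ (C.subset _ hk₀)] at h2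
  exact one_ne_zero h2

include hz₀ hk₀ in
/-- **`Ȟ⁰(𝔙, L|_Z) ≠ 0` as soon as `Z` meets a member of `𝔙`**: the class of the point cocycle is
non-zero (there are no `0`-coboundaries). [cite: SerreFAC1955, n° 20 Prop. 2] -/
theorem nontrivial_zcohomology_zero : Nontrivial (C.zcohomology Z 0) := by
  let c : ↥(NatCochain.cocycles (R := ℂ) (fun a ↦ C.zdelta Z a) 0) :=
    ⟨C.pointCocycle hz₀ k₀, (NatCochain.mem_cocycles_iff _).2 (C.zdelta_pointCocycle hz₀ hk₀)⟩
  refine ⟨⟨NatCochain.Cohomology.mk (fun a ↦ C.zdelta Z a) 0 c, 0, fun h ↦ ?_⟩⟩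
  have h' : NatCochain.Cohomology.mk (R := ℂ) (fun a ↦ C.zdelta Z a) 0 c = 0 := h
  rw [NatCochain.Cohomology.mk_eq_zero_iff, NatCochain.coboundaries_zero, Submodule.mem_bot] at h'
  exact C.pointCocycle_ne_zero hz₀ hk₀ h'

end Point

/-! ### Finiteness for a finite `Z` and finitely many members -/

/-- For `Z` finite and finitely many members the cochains `C^a(𝔙, L|_Z)` are finite-dimensional.
[folklore] -/
theorem finiteDimensional_zCochain [Finite κ] (hZ : Z.Finite) (a : ℕ) :
    FiniteDimensional ℂ (C.ZCochain Z a) := by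
  haveI : ∀ J : Fin (a + 1) → κ, FiniteDimensional ℂ ↥(suppFunOn M (Z ∩ cechSet C.U J)) := fun J ↦
    suppFunOn.finiteDimensional (hZ.subset inter_subset_left)
  haveI : Finite (Fin (a + 1) → κ) := inferInstance
  infer_instance

/-- For `Z` finite and finitely many members `Ȟ^q(𝔙, L|_Z)` is finite-dimensional. [folklore] -/
theorem finiteDimensional_zcohomology [Finite κ] (hZ : Z.Finite) (q : ℕ) :
    FiniteDimensional ℂ (C.zcohomology Z q) := by
  haveI := C.finiteDimensional_zCochain Z hZ q
  exact Module.Finite.of_surjective (NatCochain.Cohomology.mk (R := ℂ) (fun a ↦ C.zdelta Z a) q)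
    (NatCochain.Cohomology.mk_surjective _ q)

end FramedCover

end HolomorphicLineBundle

end Literature.Geometry.Kaehler

end
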